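import Summits.CriticalPhenomena.SAWScalingLimit.Theses.SAWDevelopingMap
import Literature.Barriers.CriticalPhenomena.ParafermionicHalfCauchyRiemann

/-!
# Sketch — crux-ideate stmt-CriticalPhenomena-8298 (`QCIdentification`), ideator 3, round 1

First-lemma signatures of the three idea cards (they only need to elaborate; nothing is proved here):

* `NoBranching` / `FirstLemma_TurningBudget` (card `turning-budget-immersion`): under (K) the developing
  map has no branch point at any interior hexagon centre — the sum of the six consecutive argument
  increments of the `∂H`-mode `S(v) = F(p₀)+F(p₁)+F(p₂)` around the hexagon is `0` (not `2π`).
* `ZigzagLateralUniversality` (card `straight-side-reflection-poisson`): the lattice-scale statement the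
  `F(b_δ)`-normalisation of `HexObservableLimit` needs and (K),(M) do not supply — adjacent boundary values
  on an exact zigzag piece far from the source agree asymptotically; plus the classical extended maximum
  principle `BoundedHarmonicRigidity` the Poisson-uniqueness step uses.
* `KinkLaw` (card `kink-dipole-balance`): the dilute atom of BoundaryBalance — an isolated one-row step on
  a zigzag boundary carries the universal ratio `3√3 / (16 sin(π/8)) = 0.84864…` relative to regular
  zigzag boundary mid-edges; a necessary consequence of `HexObservableLimit` (all discretisations) + (K).
-/

namespace Summit.CriticalPhenomena.SAWScalingLimit.Cruxes.QCIdentification.Sketch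

open scoped BigOperators
open Summit.CriticalPhenomena.SAWScalingLimit.Theses.SAWDevelopingMap
open Literature.Probability.LatticeModels Literature.Probability.RandomPlanarGeometry.SAW
open Literature.Barriers.CriticalPhenomena

noncomputable section

/-- The three neighbours of a hexagonal-lattice vertex, explicitly (up face `(x,0)`: `(x,1), (x-e₀,1),
(x-e₁,1)`; down face `(y,1)`: `(y,0), (y+e₀,0), (y+e₁,0)`), in counterclockwise order of the mid-edges. -/
def hexNbr (v : HexVertex) (k : Fin 3) : HexVertex :=
  if v.2 = 0 then
    ![(v.1, 1), (v.1 - Pi.single 0 1, 1), (v.1 - Pi.single 1 1, 1)] k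
  else
    ![(v.1, 0), (v.1 + Pi.single 0 1, 0), (v.1 + Pi.single 1 1, 0)] k

/-- The `∂H`-mode of a mid-edge function around a vertex: `S(v) = F(p₀) + F(p₁) + F(p₂)` (labelling
independent; `= 6 i √3 ∂H` on the triangle `Δ_v` of the developing map). -/
def modeSum (F : Sym2 HexVertex → ℂ) (v : HexVertex) : ℂ :=
  F s(v, hexNbr v 0) + F s(v, hexNbr v 1) + F s(v, hexNbr v 2)

/-- The critical observable of the route, abbreviated. -/
def Fobs (Λ : Finset HexVertex) (a : Sym2 HexVertex) : Sym2 HexVertex → ℂ :=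
  hexParafermionicObservable Λ a hexCriticalFugacity (5 / 8)

/-- **No branching of the developing map.** For every simply connected `Λ`, boundary source `a` and
every site `x` of `𝕋` whose six surrounding faces (the hexagon of `ℍ` centred at `x`) lie in `Λ`, if the
`∂H`-modes around the hexagon are non-zero then the six consecutive argument increments
`arg (S(v_{j+1}) / S(v_j))` (each in `(-π, π]`) sum to `0`: the PL developing map winds exactly once around
`H(x)` (local homeomorphism), never `2, 3, …` times. -/
def NoBranching : Prop :=
  ∀ (Λ : Finset HexVertex), hexDomainSimplyConnected Λ → ∀ a ∈ hexDomainBoundary Λ, ∀ x : Site 2,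
    (∀ j : Fin 6, HexKernel.face x j ∈ Λ) →
    (∀ j : Fin 6, modeSum (Fobs Λ a) (HexKernel.face x j) ≠ 0) →
    ∑ j : Fin 6, Complex.arg (modeSum (Fobs Λ a) (HexKernel.face x (j + 1)) /
        modeSum (Fobs Λ a) (HexKernel.face x j)) = 0

/-- First lemma of card `turning-budget-immersion`: (K) ⇒ no branching (PL Gauss–Bonnet on the carrier
plus the exact turning budget `(3/8)·2π + 2·(5π/8) = 2π` of the image polygon). -/
def FirstLemma_TurningBudget : Prop := NoFoldBound → NoBranching

/-- **Lateral universality of the zigzag boundary layer (N1), mesoscopic form.** For every `ε > 0`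
there are `η > 0` and `M₀` such that for all `M ≥ M₀`, every simply connected `Λ`, every boundary source
`a`, and every two bottom-boundary vertices `(x,0)`, `(x',0)` of the same row at mutual distance `≤ η M`,
if `Λ` coincides with the exact zigzag half-plane `{w | x 1 ≤ w.1 1}` within Euclidean radius `M` of
`(x,0)` and `a` is at distance `≥ M`, then the boundary values at the two downward mid-edges agree up to
relative error `ε`.  (Kennedy–Lawler-type locality of the boundary factor on a flat zigzag piece; it is what
the `F(b_δ)`-normalisation of `HexObservableLimit` needs beyond (K),(M): with the exact window identity
`Σ_{window} F(p) = 2√3 i (H(Q) - H(P))` it turns the bulk limit into the point value at `b_δ`.) -/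
def ZigzagLateralUniversality : Prop :=
  ∀ ε : ℝ, 0 < ε → ∃ η : ℝ, 0 < η ∧ ∃ M₀ : ℝ, ∀ M : ℝ, M₀ ≤ M →
    ∀ (Λ : Finset HexVertex), hexDomainSimplyConnected Λ → ∀ a ∈ hexDomainBoundary Λ, ∀ x x' : Site 2,
      x' 1 = x 1 →
      dist (hexCenter ((x', 0) : HexVertex)) (hexCenter ((x, 0) : HexVertex)) ≤ η * M →
      (∀ w : HexVertex, dist (hexCenter w) (hexCenter ((x, 0) : HexVertex)) ≤ M → (w ∈ Λ ↔ x 1 ≤ w.1 1)) →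
      M ≤ dist (hexMidpoint a) (hexCenter ((x, 0) : HexVertex)) →
      let p : Sym2 HexVertex := s((x, 0), (x - Pi.single 1 1, 1))
      let p' : Sym2 HexVertex := s((x', 0), (x' - Pi.single 1 1, 1))
      ‖Fobs Λ a p - Fobs Λ a p'‖ ≤ ε * ‖Fobs Λ a p'‖

/-- **Extended maximum principle (Lindelöf) — the Poisson-uniqueness step.** A bounded harmonic function
on a bounded open set which tends to the constant `c` at every boundary point outside a finite set is
identically `c`. (Classical; not in Mathlib. Used with `u = arg h' - (5/8) arg φ'` on zigzag polygons, the
finite set being the corners, `a`, and — excluded by the turning budget — boundary critical points.) -/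
def BoundedHarmonicRigidity : Prop :=
  ∀ (Ω : Set ℂ) (u : ℂ → ℝ) (E : Finset ℂ) (c B : ℝ), IsOpen Ω → Bornology.IsBounded Ω →
    (∀ z ∈ Ω, InnerProductSpace.HarmonicAt u z) → (∀ z ∈ Ω, |u z| ≤ B) →
    (∀ ζ ∈ frontier Ω, ζ ∉ E → Filter.Tendsto u (nhdsWithin ζ Ω) (nhds c)) →
    ∀ z ∈ Ω, u z = c

/-- The local pattern "exact zigzag half-plane above row `m` with one gentle step down at column `x₀`":
rows `≥ m+1` are in; in row `m` the faces of the cells `(y₀, m)` with `y₀ ≥ x₀` are in, together with the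
single down-face of the cell `(x₀ - 1, m)` (so the carrier boundary descends by one 𝕋-edge of direction
`-60°` between the upper and the lower zigzag line). -/
def stepPattern (x₀ m : ℤ) (w : HexVertex) : Prop :=
  m + 1 ≤ w.1 1 ∨ (w.1 1 = m ∧ (x₀ ≤ w.1 0 ∨ (w.1 0 = x₀ - 1 ∧ w.2 = 1)))

/-- **Kink law (dilute atom of BoundaryBalance).** For every `ε > 0` there are `r : ℕ` and `M` such that
whenever `Λ` coincides with `stepPattern x₀ m` within radius `M` of the step and the source is at distance
`≥ M`, the boundary value on the kink mid-edge (between the down-face and the up-face of the cell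
`(x₀-1, m)`, outward normal `-150°`) and the one on the regular downward mid-edge `r` columns to the right
have ratio within `ε` of `κ = 3√3 / (16 sin(π/8)) = 0.84864…` — the value forced by conformal covariance of
the observable's limit on dilute-kink slopes (image step = `3/8` of the lattice step). -/
def KinkLaw : Prop :=
  ∀ ε : ℝ, 0 < ε → ∃ r : ℕ, ∃ M : ℝ, ∀ (Λ : Finset HexVertex), hexDomainSimplyConnected Λ →
    ∀ a ∈ hexDomainBoundary Λ, ∀ x₀ m : ℤ,
      let c : ℂ := hexCenter ((![x₀ - 1, m], 1) : HexVertex)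
      (∀ w : HexVertex, dist (hexCenter w) c ≤ M → (w ∈ Λ ↔ stepPattern x₀ m w)) →
      M ≤ dist (hexMidpoint a) c →
      let pK : Sym2 HexVertex := s((![x₀ - 1, m], 1), (![x₀ - 1, m], 0))
      let pr : Sym2 HexVertex := s((![x₀ + r, m], 0), (![x₀ + r, m] - Pi.single 1 1, 1))
      |‖Fobs Λ a pK‖ / ‖Fobs Λ a pr‖ - 3 * Real.sqrt 3 / (16 * Real.sin (Real.pi / 8))| ≤ ε

end

end Summit.CriticalPhenomena.SAWScalingLimit.Cruxes.QCIdentification.Sketch
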